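import Literature.NumberTheory.GelbartRogawski1991.LocalUnitaryFrameTransport
import Literature.NumberTheory.GelbartRogawski1991.LocalUnitaryUndoubling
import Literature.NumberTheory.GelbartRogawski1991.LocalDoubledUnitarySiegel
import Literature.NumberTheory.Automorphic.UnitaryGroupLocalCongr
import HarnessLib

/-!
# Conjugation of the doubled groups by a RATIONAL FRAME `P ⊕ P`: `U((PᵀT₀P)^𝔻)(F_v) → U(T₀^𝔻)(F_v)` preserves `P_Δ`, `det_Δ`,
# and is compatible with `g ↦ g ⊕ 1`

Topic `NumberTheory/GelbartRogawski1991`; namespace `Literature.NumberTheory.GelbartRogawski1991.UnitaryDualPair.LocalSplitting` (home of ★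
`IsSiegelDelta`, `deltaBlock`, `detDelta`, `chiDet`, `inlLoc`, `FrameTransport.*`).  KERNEL ONLY: theorems; no definition, no named fact, no
`sorry`.  Cell `hodgecm-mathlib` (D-0151), programme P2 (crux H413 = stmt-HodgeConjecture-24833), brick **(FN)** «RATIONAL-FRAME NATURALITY of
the CM local package» of the N3 road (lead B-p18 (g29), 2026-08-31; consumer of the head: `LocalSplittingCMFrameNaturality`) — the MATRIX AND
MODEL LAYER, sibling of ★ `LocalDoubledRationalSimilitudeSiegel` (rational similitude `k ⊕ k` of ONE doubled group) for a rational CHANGE OF FRAME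
between TWO doubled groups.

THE OBJECTS (no new definition).  `E/F` CM-type quadratic with `c`; `T₀, T₀' ∈ Sym_n(F)` related by a RATIONAL frame `P ∈ GL_n(F)`,
`Pᵀ T₀ P = T₀'`; `J = T₀ ⊗ 1`, `J' = T₀' ⊗ 1`; the doubled Gram matrices `T₀^𝔻 = T₀ ⊕ (−T₀)`, `T₀'^𝔻` (★ `gramD`), `J^𝔻`, `J'^𝔻`; the DOUBLED FRAME
`PD := reindexGL e₂ (blockDiagGL (P, P)) ∈ GL_{n+n}(F)` (hypothesis `hPD`), which satisfies **`PDᵀ T₀^𝔻 PD = T₀'^𝔻`** (`transpose_pd_mul_gramD_mul_pd`),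
so that the tree's ★ `FrameTransport` applies at BOTH levels: `frameConj P : U(J')(F_v) ≃ₜ* U(J)(F_v)` and `frameConj PD : U(J'^𝔻)(F_v) ≃ₜ*
U(J^𝔻)(F_v)`, `g ↦ PD g PD⁻¹` ([PlatonovRapinchuk1994, §2.3]: conjugate forms have conjugate unitary groups; [MoeglinVignerasWaldspurger1987,
Chap. 2 II Remarque (3)]: transport of structure along an isometry of symplectic spaces).
* §1 `transpose_pd_mul_gramD_mul_pd`; the per-place formula **`coe_frameConj_apply_apply`** of ★ `FrameTransport.frameConj` (ANY rank `N`, any frame):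
  `(P g' P⁻¹)_w = P_w g'_w P_w⁻¹` in `GL_N(E_w)` for every `w ∣ v` (`framePloc P = toLocalGL (P ⊗ 1)`, `framePloc_eq_toLocalGL`).
* §2 at every `w ∣ v`: the `e₂`-blocks of `(PD h PD⁻¹)_w` are the `P_w`-conjugates of those of `h_w`; hence **`deltaBlock_frameConj_pd`**
  (`(PD h PD⁻¹)_Δ = P_w h_Δ P_w⁻¹`), **`detDelta_frameConj_pd`** (`det_Δ` is preserved), **`isSiegelDelta_frameConj_pd_iff`** (`h ∈ P_Δ(J'^𝔻) ↔
  PD h PD⁻¹ ∈ P_Δ(J^𝔻)`, through ★ `isSiegelDelta_iff_blocks`), `chiDet_frameConj_pd`, `norm_detDelta_frameConj_pd` — the hypotheses «`θ P_Δ ⊆ P_Δ`,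
  `det_Δ ∘ θ = det_Δ`» of the tree's Kudla-rigidity transports (★ `LocalKudlaSplittingRigidity`), for `θ = Ad(PD)` BETWEEN the two doubled groups.
* §3 **`frameConj_pd_inlLoc`**: `PD (g' ⊕ 1) PD⁻¹ = (P g' P⁻¹) ⊕ 1` (compatibility with ★ `inlLoc`, for the undoubling step).
* The MODEL layer (`frameOp_{PD}` is `⊠`-multiplicative, `frameW_{PD}` preserves `ℓ_Δ`, `ℓ_Y`, movers transport) is the sibling `LocalDoubledRationalFrameModels`.
Nothing of the cited sources is asserted; HC_CM is proved only modulo the printed citations until rung 0 closes.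

## References
* [Kudla1994] S. Kudla, Israel J. Math. 87 (1994), §2 (the Siegel parabolic of the doubled space), §3 Thm. 3.1.
* [HarrisKudlaSweet1996] M. Harris, S. Kudla, W. Sweet, J. AMS 9 (1996), §1 (1.9), (1.11), (1.15).
* [PlatonovRapinchuk1994] V. Platonov, A. Rapinchuk, Algebraic Groups and Number Theory (1994), §2.3, §5.1.
* [MoeglinVignerasWaldspurger1987] LNM 1291 (1987), Chap. 2 I.7, II.1 Rem. (6), II Remarque (3).
* [Weil1964] A. Weil, Acta Math. 111 (1964), n° 13 p. 160, n° 34.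
-/

set_option autoImplicit false
-- buildfix G11b-3 recipe (LEDGER B13-1/B13-3), as in the GelbartRogawski1991 siblings: elaborate sequentially.
set_option Elab.async false

noncomputable section

open scoped Matrix
open NumberField IsDedekindDomain Matrix
open Literature.RepresentationTheory.HeisenbergGroup
open Literature.NumberTheory.Automorphic Literature.NumberTheory.Automorphic.UnitaryGroup Literature.NumberTheory.Weil1964

namespace Literature.NumberTheory.GelbartRogawski1991.UnitaryDualPair.LocalSplitting

/-! ## §0 Block algebra -/

section Blocks

variable {R : Type*} [CommRing R] {m : Type*} [Fintype m]

/-- coercion of `GeneralLinearGroup.map` (definitional). [folklore] -/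
private theorem coe_glMap' {S : Type*} [CommRing S] {l : Type*} [Fintype l] [DecidableEq l] (f : R →+* S) (g : GL l R) :
    ((Matrix.GeneralLinearGroup.map f g : GL l S) : Matrix l l S) = (g : Matrix l l R).map f := rfl

/-- `(k ⊕ k) · (A B; C D) · (k′ ⊕ k′) = (kAk′ kBk′; kCk′ kDk′)`. [folklore] -/
private theorem fromBlocks_diag_mul_mul_fromBlocks_diag' (k k' : Matrix m m R) (A B C D : Matrix m m R) :
    Matrix.fromBlocks k 0 0 k * Matrix.fromBlocks A B C D * Matrix.fromBlocks k' 0 0 k' =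
      Matrix.fromBlocks (k * A * k') (k * B * k') (k * C * k') (k * D * k') := by
  rw [Matrix.fromBlocks_multiply, Matrix.fromBlocks_multiply]
  simp only [Matrix.zero_mul, Matrix.mul_zero, add_zero, zero_add]

/-- the `e₂`-blocks of a conjugate by `k ⊕ k`: `(k ⊕ k) M (k′ ⊕ k′) = (k Mᵢⱼ k′)ᵢⱼ`. [folklore] -/
private theorem fromBlocks_diag_conj_eq' (k k' : Matrix m m R) (M : Matrix (m ⊕ m) (m ⊕ m) R) :
    Matrix.fromBlocks k 0 0 k * M * Matrix.fromBlocks k' 0 0 k' =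
      Matrix.fromBlocks (k * M.toBlocks₁₁ * k') (k * M.toBlocks₁₂ * k') (k * M.toBlocks₂₁ * k') (k * M.toBlocks₂₂ * k') := by
  conv_lhs => rw [← Matrix.fromBlocks_toBlocks M]
  exact fromBlocks_diag_mul_mul_fromBlocks_diag' k k' _ _ _ _

/-- `submatrix` along an equivalence is multiplicative (three factors). [folklore] -/
private theorem submatrix_mul_mul' {l : Type*} [Fintype l] (e : l ≃ m) (A B C : Matrix m m R) :
    (A * B * C).submatrix e e = A.submatrix e e * B.submatrix e e * C.submatrix e e := by
  rw [Matrix.submatrix_mul_equiv, Matrix.submatrix_mul_equiv]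

end Blocks

variable (F : Type) [Field F] [NumberField F] (E : Type) [Field E] [NumberField E] [Algebra F E]
  (c : E ≃ₐ[F] E) (v : HeightOneSpectrum (𝓞 F)) (n : ℕ) {T₀ T₀' : Matrix (Fin n) (Fin n) F}
  {J : Matrix (Fin n) (Fin n) E} (hJ : J = T₀.map (algebraMap F E))
  {J' : Matrix (Fin n) (Fin n) E} (hJ' : J' = T₀'.map (algebraMap F E))
  {JD : Matrix (Fin (n + n)) (Fin (n + n)) E} (hJD : JD = (gramD F n T₀).map (algebraMap F E))
  {JD' : Matrix (Fin (n + n)) (Fin (n + n)) E} (hJD' : JD' = (gramD F n T₀').map (algebraMap F E))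
  (P : GL (Fin n) F) (hP : ((P : Matrix (Fin n) (Fin n) F))ᵀ * T₀ * (P : Matrix (Fin n) (Fin n) F) = T₀')
  {PD : GL (Fin (n + n)) F} (hPD : PD = UnitaryGroup.reindexGL (e₂ n) (UnitaryGroup.blockDiagGL (P, P)))

/-! ## §1 The doubled frame `PD = P ⊕ P` and the per-place formula of `frameConj` -/

section Frame

omit [NumberField F] in
include hP hPD in
/-- **`PDᵀ · T₀^𝔻 · PD = T₀'^𝔻`**: the doubled matrix of a rational frame `Pᵀ T₀ P = T₀'` is a frame `T₀^𝔻 ↦ T₀'^𝔻` of the doubled Gram matrices.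
[cite: HarrisKudlaSweet1996, §1 (1.9)] [cite: MoeglinVignerasWaldspurger1987, Chap. 2 II Remarque (3)] -/
theorem transpose_pd_mul_gramD_mul_pd :
    ((PD : Matrix (Fin (n + n)) (Fin (n + n)) F))ᵀ * gramD F n T₀ * (PD : Matrix (Fin (n + n)) (Fin (n + n)) F) = gramD F n T₀' := by
  subst hPD
  rw [UnitaryGroup.coe_reindexGL, UnitaryGroup.coe_blockDiagGL, gramD, gramD, Matrix.reindex_apply, Matrix.reindex_apply,
    Matrix.transpose_submatrix, Matrix.fromBlocks_transpose, ← submatrix_mul_mul', Matrix.fromBlocks_multiply, Matrix.fromBlocks_multiply]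
  simp only [Matrix.transpose_zero, Matrix.zero_mul, Matrix.mul_zero, add_zero, zero_add, Matrix.mul_neg, Matrix.neg_mul, hP, neg_zero]
  rfl

/-- **`framePloc P = toLocalGL (P ⊗ 1)`**: the frame read in `GL_N(E ⊗ F_v)` through `F_v` (★ `FrameTransport.framePloc`) IS the rational matrix
`P ⊗ 1 ∈ GL_N(E)` read at `v` (★ `toLocalGL`). [cite: PlatonovRapinchuk1994, §5.1] -/
theorem framePloc_eq_toLocalGL {N : ℕ} (Q : GL (Fin N) F) :
    FrameTransport.framePloc F E v N Q = toLocalGL E v (Matrix.GeneralLinearGroup.map (algebraMap F E) Q) := by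
  refine Units.ext ?_
  rw [FrameTransport.coe_framePloc, coe_toLocalGL_apply, coe_glMap', Matrix.map_map]
  refine Matrix.ext fun i j => ?_
  rw [Matrix.map_apply, Matrix.map_apply, RingHom.comp_apply, Function.comp_apply, IsDedekindDomain.HeightOneSpectrum.algebraMap_adicCompletion,
    Function.comp_apply, Algebra.algebraMap_self_apply, toLocalRing_coe]

/-- **the per-place formula of `frameConj`** (any rank, any frame): the `w`-component of `P g' P⁻¹ ∈ U(J)(F_v)` is `P_w g'_w P_w⁻¹` in
`GL_N(E_w)`, `P_w = P` read in `GL_N(E_w)`. [cite: PlatonovRapinchuk1994, §2.3] -/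
theorem coe_frameConj_apply_apply {N : ℕ} {T T' : Matrix (Fin N) (Fin N) F} {K : Matrix (Fin N) (Fin N) E} (hK : K = T.map (algebraMap F E))
    {K' : Matrix (Fin N) (Fin N) E} (hK' : K' = T'.map (algebraMap F E)) (Q : GL (Fin N) F)
    (hQ : ((Q : Matrix (Fin N) (Fin N) F))ᵀ * T * (Q : Matrix (Fin N) (Fin N) F) = T') (g' : UnitaryGroup.localPi E c N K' v)
    (w : PlacesOver E v) :
    ((FrameTransport.frameConj F E c v N hK hK' Q hQ g' : UnitaryGroup.localPi E c N K v) : UnitaryGroup.LocalGLPi E N v) w =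
      Matrix.GeneralLinearGroup.map (algebraMap E (w.1.adicCompletion E)) (Matrix.GeneralLinearGroup.map (algebraMap F E) Q) *
        (g' : UnitaryGroup.LocalGLPi E N v) w *
        (Matrix.GeneralLinearGroup.map (algebraMap E (w.1.adicCompletion E)) (Matrix.GeneralLinearGroup.map (algebraMap F E) Q))⁻¹ := by
  rw [show FrameTransport.frameConj F E c v N hK hK' Q hQ g' = (UnitaryGroup.localPiEquiv E c N K v).symm
      (FrameTransport.frameConjLocal F E c v N hK hK' Q hQ (UnitaryGroup.localPiEquiv E c N K' v g')) from rfl,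
    UnitaryGroup.coe_localPiEquiv_symm_apply, FrameTransport.coe_frameConjLocal, map_mul, map_mul, map_inv,
    UnitaryGroup.coe_localPiEquiv_apply, ContinuousMulEquiv.apply_symm_apply, framePloc_eq_toLocalGL, Pi.mul_apply, Pi.mul_apply,
    Pi.inv_apply, localGLPiEquiv_toLocalGL_apply]

end Frame

/-! ## §2 `Ad(PD)` at a place `w ∣ v`: blocks, `det_Δ`, `P_Δ`, `χ(det_Δ)` -/

section PlaceBlocks

omit [NumberField F] in
include hPD in
/-- the matrix of `PD` at `w`: `reindex e₂ e₂ (P_w ⊕ P_w)`. [cite: PlatonovRapinchuk1994, §5.1] -/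
theorem coe_map_pd (w : PlacesOver E v) :
    ((Matrix.GeneralLinearGroup.map (algebraMap E (w.1.adicCompletion E)) (Matrix.GeneralLinearGroup.map (algebraMap F E) PD) :
        GL (Fin (n + n)) (w.1.adicCompletion E)) : Matrix (Fin (n + n)) (Fin (n + n)) (w.1.adicCompletion E)) =
      Matrix.reindex (e₂ n) (e₂ n) (Matrix.fromBlocks
        ((Matrix.GeneralLinearGroup.map (algebraMap E (w.1.adicCompletion E)) (Matrix.GeneralLinearGroup.map (algebraMap F E) P) :
          GL (Fin n) (w.1.adicCompletion E)) : Matrix _ _ _) 0 0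
        ((Matrix.GeneralLinearGroup.map (algebraMap E (w.1.adicCompletion E)) (Matrix.GeneralLinearGroup.map (algebraMap F E) P) :
          GL (Fin n) (w.1.adicCompletion E)) : Matrix _ _ _)) := by
  subst hPD
  rw [coe_glMap', coe_glMap', coe_glMap', coe_glMap', UnitaryGroup.coe_reindexGL, UnitaryGroup.coe_blockDiagGL, Matrix.map_map, Matrix.map_map,
    Matrix.reindex_apply, Matrix.reindex_apply, ← Matrix.submatrix_map, Matrix.fromBlocks_map,
    Matrix.map_zero _ (by rw [Function.comp_apply, map_zero, map_zero])]

omit [NumberField F] in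
include hPD in
/-- the matrix of `PD⁻¹` at `w`: `reindex e₂ e₂ (P_w⁻¹ ⊕ P_w⁻¹)`. [cite: PlatonovRapinchuk1994, §5.1] -/
theorem coe_map_pd_inv (w : PlacesOver E v) :
    (((Matrix.GeneralLinearGroup.map (algebraMap E (w.1.adicCompletion E)) (Matrix.GeneralLinearGroup.map (algebraMap F E) PD))⁻¹ :
        GL (Fin (n + n)) (w.1.adicCompletion E)) : Matrix (Fin (n + n)) (Fin (n + n)) (w.1.adicCompletion E)) =
      Matrix.reindex (e₂ n) (e₂ n) (Matrix.fromBlocks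
        (((Matrix.GeneralLinearGroup.map (algebraMap E (w.1.adicCompletion E)) (Matrix.GeneralLinearGroup.map (algebraMap F E) P))⁻¹ :
          GL (Fin n) (w.1.adicCompletion E)) : Matrix _ _ _) 0 0
        (((Matrix.GeneralLinearGroup.map (algebraMap E (w.1.adicCompletion E)) (Matrix.GeneralLinearGroup.map (algebraMap F E) P))⁻¹ :
          GL (Fin n) (w.1.adicCompletion E)) : Matrix _ _ _)) := by
  subst hPD
  simp only [← map_inv, Prod.inv_mk]
  exact coe_map_pd F E v n P⁻¹ rfl w

include hPD in
/-- **the `e₂`-blocks of `(PD h PD⁻¹)_w` are the `P_w`-conjugates of the `e₂`-blocks of `h_w`.** [cite: Kudla1994, §2] [cite: PlatonovRapinchuk1994, §2.3] -/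
theorem reindex_coe_frameConj_pd (h : UnitaryGroup.localPi E c (n + n) JD' v) (w : PlacesOver E v) :
    Matrix.reindex (e₂ n).symm (e₂ n).symm
        (((FrameTransport.frameConj F E c v (n + n) hJD hJD' PD (transpose_pd_mul_gramD_mul_pd F n P hP hPD) h :
            UnitaryGroup.localPi E c (n + n) JD v) : UnitaryGroup.LocalGLPi E (n + n) v) w :
          Matrix (Fin (n + n)) (Fin (n + n)) (w.1.adicCompletion E)) =
      Matrix.fromBlocks ((Matrix.GeneralLinearGroup.map (algebraMap E (w.1.adicCompletion E)) (Matrix.GeneralLinearGroup.map (algebraMap F E) P) :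
            GL (Fin n) (w.1.adicCompletion E)) : Matrix _ _ _) 0 0
          ((Matrix.GeneralLinearGroup.map (algebraMap E (w.1.adicCompletion E)) (Matrix.GeneralLinearGroup.map (algebraMap F E) P) :
            GL (Fin n) (w.1.adicCompletion E)) : Matrix _ _ _) *
        Matrix.reindex (e₂ n).symm (e₂ n).symm
          (((h : UnitaryGroup.LocalGLPi E (n + n) v) w : GL (Fin (n + n)) (w.1.adicCompletion E)) : Matrix _ _ (w.1.adicCompletion E)) *
        Matrix.fromBlocks (((Matrix.GeneralLinearGroup.map (algebraMap E (w.1.adicCompletion E)) (Matrix.GeneralLinearGroup.map (algebraMap F E) P))⁻¹ :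
            GL (Fin n) (w.1.adicCompletion E)) : Matrix _ _ _) 0 0
          (((Matrix.GeneralLinearGroup.map (algebraMap E (w.1.adicCompletion E)) (Matrix.GeneralLinearGroup.map (algebraMap F E) P))⁻¹ :
            GL (Fin n) (w.1.adicCompletion E)) : Matrix _ _ _) := by
  rw [coe_frameConj_apply_apply, Units.val_mul, Units.val_mul, coe_map_pd F E v n P hPD w, coe_map_pd_inv F E v n P hPD w]
  simp only [Matrix.reindex_apply, submatrix_mul_mul', Matrix.submatrix_submatrix, Equiv.symm_symm, Equiv.symm_comp_self, Matrix.submatrix_id_id]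

include hPD in
/-- **`(PD h PD⁻¹)_Δ = P_w · h_Δ · P_w⁻¹`** (the `Δ`-block `h₁₁ + h₁₂`, ★ `deltaBlock`). [cite: Kudla1994, §3] [cite: HarrisKudlaSweet1996, §1 (1.15)] -/
theorem deltaBlock_frameConj_pd (h : UnitaryGroup.localPi E c (n + n) JD' v) (w : PlacesOver E v) :
    deltaBlock F E c v n w (FrameTransport.frameConj F E c v (n + n) hJD hJD' PD (transpose_pd_mul_gramD_mul_pd F n P hP hPD) h) =
      ((Matrix.GeneralLinearGroup.map (algebraMap E (w.1.adicCompletion E)) (Matrix.GeneralLinearGroup.map (algebraMap F E) P) :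
            GL (Fin n) (w.1.adicCompletion E)) : Matrix _ _ _) *
        deltaBlock F E c v n w h *
        (((Matrix.GeneralLinearGroup.map (algebraMap E (w.1.adicCompletion E)) (Matrix.GeneralLinearGroup.map (algebraMap F E) P))⁻¹ :
            GL (Fin n) (w.1.adicCompletion E)) : Matrix _ _ _) := by
  unfold deltaBlock
  simp only []
  rw [reindex_coe_frameConj_pd F E c v n hJD hJD' P hP hPD h w, fromBlocks_diag_conj_eq', Matrix.toBlocks_fromBlocks₁₁, Matrix.toBlocks_fromBlocks₁₂,
    ← Matrix.add_mul, ← Matrix.mul_add]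

include hPD in
/-- **`det_Δ (PD h PD⁻¹) = det_Δ h`** at every place `w ∣ v`. [cite: Kudla1994, §3] [cite: HarrisKudlaSweet1996, §1 (1.15)] -/
theorem detDelta_frameConj_pd (h : UnitaryGroup.localPi E c (n + n) JD' v) (w : PlacesOver E v) :
    detDelta F E c v n w (FrameTransport.frameConj F E c v (n + n) hJD hJD' PD (transpose_pd_mul_gramD_mul_pd F n P hP hPD) h) =
      detDelta F E c v n w h := by
  unfold detDelta
  rw [deltaBlock_frameConj_pd F E c v n hJD hJD' P hP hPD h w]
  exact Matrix.det_units_conj _ _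

include hPD in
/-- **`P_Δ` is carried to `P_Δ`**: `PD h PD⁻¹ ∈ P_Δ(J^𝔻) ↔ h ∈ P_Δ(J'^𝔻)` (the block condition `h₁₁ + h₁₂ = h₂₁ + h₂₂`, ★ `isSiegelDelta_iff_blocks`, is
conjugated by `P_w`). [cite: Kudla1994, §2, §3] [cite: HarrisKudlaSweet1996, §1 (1.11)] -/
theorem isSiegelDelta_frameConj_pd_iff [Algebra.IsQuadraticExtension F E] {δ : E} (hcδ : c δ = -δ) (hδ : δ ≠ 0) {d : F}
    (hd : δ * δ = algebraMap F E d) (hT₀ : T₀.IsSymm) (hT₀' : T₀'.IsSymm) (h : UnitaryGroup.localPi E c (n + n) JD' v) :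
    IsSiegelDelta F E c hcδ hδ hd v n hT₀ hJD (FrameTransport.frameConj F E c v (n + n) hJD hJD' PD (transpose_pd_mul_gramD_mul_pd F n P hP hPD) h) ↔
      IsSiegelDelta F E c hcδ hδ hd v n hT₀' hJD' h := by
  rw [isSiegelDelta_iff_blocks, isSiegelDelta_iff_blocks]
  refine forall_congr' fun w => ?_
  rw [reindex_coe_frameConj_pd F E c v n hJD hJD' P hP hPD h w, fromBlocks_diag_conj_eq', Matrix.toBlocks_fromBlocks₁₁, Matrix.toBlocks_fromBlocks₁₂,
    Matrix.toBlocks_fromBlocks₂₁, Matrix.toBlocks_fromBlocks₂₂, ← Matrix.add_mul, ← Matrix.mul_add, ← Matrix.add_mul, ← Matrix.mul_add]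
  constructor
  · intro h'
    have h'' := congrArg (fun M => (((Matrix.GeneralLinearGroup.map (algebraMap E (w.1.adicCompletion E)) (Matrix.GeneralLinearGroup.map (algebraMap F E) P))⁻¹ :
        GL (Fin n) (w.1.adicCompletion E)) : Matrix _ _ _) * M *
        ((Matrix.GeneralLinearGroup.map (algebraMap E (w.1.adicCompletion E)) (Matrix.GeneralLinearGroup.map (algebraMap F E) P) :
          GL (Fin n) (w.1.adicCompletion E)) : Matrix _ _ _)) h'
    simpa only [Matrix.mul_assoc, Units.inv_mul, Matrix.mul_one, Units.inv_mul_cancel_left] using h''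
  · intro h'
    rw [h']

include hPD in
/-- **`χ_v(det_Δ (PD h PD⁻¹)) = χ_v(det_Δ h)`** for every family of characters `χ_w`. [cite: HarrisKudlaSweet1996, §1 (1.15)] -/
theorem chiDet_frameConj_pd (χv : ∀ w : PlacesOver E v, (w.1.adicCompletion E)ˣ →* ℂˣ) (h : UnitaryGroup.localPi E c (n + n) JD' v) :
    chiDet F E c v n χv (FrameTransport.frameConj F E c v (n + n) hJD hJD' PD (transpose_pd_mul_gramD_mul_pd F n P hP hPD) h) = chiDet F E c v n χv h := by
  classical
  unfold chiDet
  refine Finset.prod_congr rfl fun w _ => ?_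
  have e := detDelta_frameConj_pd F E c v n hJD hJD' P hP hPD h w
  by_cases hu : IsUnit (detDelta F E c v n w h)
  · have hu' : IsUnit (detDelta F E c v n w (FrameTransport.frameConj F E c v (n + n) hJD hJD' PD (transpose_pd_mul_gramD_mul_pd F n P hP hPD) h)) := by
      rw [e]; exact hu
    have hunit : hu'.unit = hu.unit := Units.ext (by rw [IsUnit.unit_spec, IsUnit.unit_spec, e])
    rw [dif_pos hu', dif_pos hu, hunit]
  · have hu' : ¬ IsUnit (detDelta F E c v n w (FrameTransport.frameConj F E c v (n + n) hJD hJD' PD (transpose_pd_mul_gramD_mul_pd F n P hP hPD) h)) := by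
      rw [e]; exact hu
    rw [dif_neg hu', dif_neg hu]

include hPD in
/-- the modulus `‖det_Δ‖` is preserved by `Ad(PD)`. [cite: HarrisKudlaSweet1996, §1 (1.16)] -/
theorem norm_detDelta_frameConj_pd (h : UnitaryGroup.localPi E c (n + n) JD' v) (w : PlacesOver E v) :
    ‖detDelta F E c v n w (FrameTransport.frameConj F E c v (n + n) hJD hJD' PD (transpose_pd_mul_gramD_mul_pd F n P hP hPD) h)‖ =
      ‖detDelta F E c v n w h‖ := by
  rw [detDelta_frameConj_pd F E c v n hJD hJD' P hP hPD h w]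

end PlaceBlocks

/-! ## §3 `Ad(PD)(g ⊕ 1) = Ad(P)(g) ⊕ 1` -/

section Inl

include hPD in
/-- **`PD (g' ⊕ 1) PD⁻¹ = (P g' P⁻¹) ⊕ 1`**: the doubled frame conjugation is compatible with `g ↦ g ⊕ 1` (★ `inlLoc`) and the frame conjugation on
`U(J')(F_v)`. [cite: GelbartRogawski1991, §3.1 Prop. 3.1.1 p. 455 L1–3] [cite: PlatonovRapinchuk1994, §2.3] -/
theorem frameConj_pd_inlLoc (g' : UnitaryGroup.localPi E c n J' v) :
    FrameTransport.frameConj F E c v (n + n) hJD hJD' PD (transpose_pd_mul_gramD_mul_pd F n P hP hPD) (inlLoc F E c v n hJ' hJD' g') =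
      inlLoc F E c v n hJ hJD (FrameTransport.frameConj F E c v n hJ hJ' P hP g') := by
  refine Subtype.ext (funext fun w => Units.ext ?_)
  apply (Matrix.reindex (e₂ n).symm (e₂ n).symm).injective
  rw [reindex_coe_frameConj_pd F E c v n hJD hJD' P hP hPD _ w, inlLoc_apply, inlLoc_apply, UnitaryGroup.coe_reindexGL, UnitaryGroup.coe_reindexGL,
    UnitaryGroup.coe_blockDiagGL, UnitaryGroup.coe_blockDiagGL, Matrix.reindex_apply, Matrix.reindex_apply, Matrix.reindex_apply, Matrix.reindex_apply,
    Matrix.submatrix_submatrix, Matrix.submatrix_submatrix]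
  simp only [Equiv.symm_symm, Equiv.symm_comp_self, Matrix.submatrix_id_id, Units.val_one]
  rw [fromBlocks_diag_mul_mul_fromBlocks_diag', Matrix.mul_one, Units.mul_inv, Matrix.mul_zero, Matrix.zero_mul, coe_frameConj_apply_apply,
    Units.val_mul, Units.val_mul]

end Inl

end Literature.NumberTheory.GelbartRogawski1991.UnitaryDualPair.LocalSplitting

end
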